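import Summits.NavierStokesRegularity.NavierStokesRegularity.Theses.AdiabaticEddy

/-!
# Route AdiabaticEddy — `Assembly` (item stmt-NavierStokesRegularity-10454)

Pure logic: the route statements `FrozenEddyCollapse` (the blow-up witness, crux #3) and
`ClayUniqueness` (= X5b, stmt-NavierStokesRegularity-0153) refute Clay (A), i.e.

  `FrozenEddyCollapse → ClayUniqueness → ¬ NavierStokesRegularity`.

This is, hypothesis for hypothesis, the route's deciding theorem
`Summit.NavierStokesRegularity.NavierStokesRegularity.Theses.AdiabaticEddy.closes`; the proof
below is self-contained (it does not invoke `closes`), so that it depends only on the item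
definitions and the Literature vocabulary.

Argument (Beale–Kato–Majda 1984, §1 bookkeeping; no new mathematics). Project
`FrozenEddyCollapse` to its first three conjuncts: a maximal classical solution `(u, p)` on
`ℝ³ × [0, T)` (`IsMaximalSmoothSolution = classical ∧ ¬ HasSmoothExtensionPast`), Leray–Hopf from
the rapidly decaying datum `u 0`. Clay (A) applied to `u 0` gives a global smooth bounded-energy
solution `(u', p')`; `ClayUniqueness` glues it to `u` on `[0, T)`; the wave-0 predicate plus joint
smoothness is, field by field, a classical solution on `Ici 0`, whose restriction to
`Ico 0 (T + 1)` extends `u` past `T` — contradicting maximality. The frozen-eddy asymptotics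
(the `∃ U P α ℓ ξ, …` tail of `FrozenEddyCollapse`) are not used.
-/

namespace Summit.NavierStokesRegularity.NavierStokesRegularity.Theorems

open Summit.NavierStokesRegularity.NavierStokesRegularity.Theses.AdiabaticEddy

/-- **Assembly** (item stmt-NavierStokesRegularity-10454, route AdiabaticEddy):
`FrozenEddyCollapse → ClayUniqueness → ¬ NavierStokesRegularity` — pure logic: the witness is a
maximal classical Leray–Hopf solution from a rapidly decaying datum with finite lifespan `T`;
Clay (A) gives a global smooth bounded-energy solution from the same datum, `ClayUniqueness`
identifies the two on `[0, T)`, and the global one restricted to `[0, T + 1)` is a classical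
extension past `T`, contradicting maximality. [folklore; cf. Beale–Kato–Majda 1984 §1] -/
theorem adiabaticEddy_assembly_proof :
    Summit.NavierStokesRegularity.NavierStokesRegularity.Theses.AdiabaticEddy.Assembly := by
  unfold Assembly
  intro hX hU hA
  obtain ⟨ν, hν, T, hT, u, p, ⟨hcl, hmax⟩, hLH, hdec, _⟩ := hX
  have h0 : (0 : ℝ) ∈ Set.Ico 0 T := ⟨le_rfl, hT⟩
  obtain ⟨u', p', hu', hp', hns, hbe⟩ :=
    hA ν hν (u 0) (hcl.contDiff_velocity h0) (hcl.divFree 0 h0) hdec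
  have heq : ∀ t ∈ Set.Ico 0 T, u' t = u t :=
    hU ν hν (u 0) hdec u' u p' p T hT hu' hp' hns hbe hcl hLH rfl
  have hcl' : Literature.Analysis.FluidPDE.IsClassicalNSSolutionOn (Set.Ici 0) ν 0 u' p' :=
    ⟨hu', hp', fun t ht x => hns.momentum t ht x, fun t ht => hns.divFree t ht⟩
  refine hmax ⟨T + 1, by linarith, u', p', ?_, heq⟩
  exact hcl'.mono (fun t ht => ht.1) (uniqueDiffOn_Ico 0 (T + 1))

end Summit.NavierStokesRegularity.NavierStokesRegularity.Theorems
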